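import Literature.Analysis.FluidPDE.TorusNSBoundedTrajectoryContinuity
import Summits.AnomalousDissipation.AnomalousDissipation.Theorems.BaireTransferDenseLoudDesignerForcesErgodicPhaseGevrey
import Summits.AnomalousDissipation.AnomalousDissipation.Theorems.BaireTransferDenseLoudDesignerForcesErgodicPeriodicOrbitA

/-!
# The enlarged phase `K' = K ∪ K₁` (tools stub P1 `stub_enlargedPhaseTools` of block N-P, line
# `ergodic-budget-selection-closing`, crux `BaireTransfer.DenseLoudDesignerForces`, stmt-AnomalousDissipation-1143)

Sorry-free summit-side assembly.  An NS phase `(K, φ)` (`IsNSPhase`, `…ErgodicLine.lean`) of the designer force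
`f_c` at viscosity `ν > 0` is enlarged to an NS phase `(K ∪ K₁, φ')`, `φ' = φ` on `[0,∞) × K`, where for a
prescribed enstrophy level `R`

  `K₁ = {x ∈ H | ∃ (u, p) classical NS_ν(f_c) on [0,∞) × T³, mean-zero slices, ‖∇u(t)‖₂² ≤ R and
        ∑_{k∈S'} e^{2σ|k|}‖û(t)(k)‖² ≤ C for all t ≥ 0, rep x =ᵐ u(0)}`

with `(σ, C)` the Foias–Temam Gevrey-smoothing constants of `f_c` for the level `R` and the lapse `1`
(`Torus.IsClassicalNSSolutionOn.gevrey_of_gradNormSq_le`, E9), and `φ'` acts on `K₁ ∖ K` as the solution map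
`x ↦ [u(t)]`.  The MATHEMATICS is in the Literature files `TorusNSBoundedTrajectorySet` (forward invariance of
`K₁`; states at times `≥ 1` of bounded-enstrophy global solutions belong to `K₁`; COMPACTNESS of `K₁` in `H`:
Gevrey compactness E10 + limits of global bounded solutions are global, `TorusClassicalNSGlobalLimit`, over the
continuation theorem E6 and the `V`-stability E3) and `TorusNSBoundedTrajectoryContinuity` (joint continuity of
the solution map on `[0,∞) × K₁`, continuity of the enstrophy on `K₁`).  This file supplies the semiflow
bookkeeping: `φ'` follows EVERY classical trajectory issued from a state of `K ∪ K₁` (forward uniqueness), whence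
`φ'_0 = id`, the semigroup law, forward invariance, the trajectories, and the pasting of the continuity statements
on the two closed pieces (`ContinuousOn.union_of_isClosed`).  The registered tools stub `stub_enlargedPhaseTools` is
proved BY NAME with exactly the registered signature; `isNSPhase_union_trajectorySet` is its force-independent core.

References: Robinson–Rodrigo–Sadowski, *The Three-Dimensional Navier–Stokes Equations* (CUP 2016) Thm 6.10 with
Thm 7.5; Foias–Temam, J. Funct. Anal. 87 (1989) Thm 1.1; Foias–Manley–Rosa–Temam (2001) Ch. IV §2.
-/

-- `Summit.<Summit>.<Problem>` is the tree's mandated summit-side namespace (CONVENTIONS §2); for this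
-- single-conjunct summit the two coincide, so the duplicate is deliberate.
set_option linter.dupNamespace false

noncomputable section

open Set Function MeasureTheory Filter
open scoped InnerProductSpace Topology ENNReal

namespace Summit.AnomalousDissipation.AnomalousDissipation.Theorems.DenseLoudDesignerForces.Ergodic

open Literature.Analysis.FunctionSpaces Literature.Analysis.FunctionSpaces.Torus
open Literature.Analysis.FluidPDE Literature.Analysis.FluidPDE.Torus
open Summit.AnomalousDissipation.AnomalousDissipation.Theses.BaireTransfer
open Summit.AnomalousDissipation.AnomalousDissipation.Theorems.DenseLoudDesignerForces.Negative

section EnlargedPhase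

variable {ν : ℝ} {F : (UnitAddTorus (Fin 3)) → (EuclideanSpace ℝ (Fin 3))} {K : Set Hsp} {φ : ℝ → Hsp → Hsp}

/-! ## §1 States and trajectories -/

/-- An honest (smooth, divergence-free, mean-zero) field representing the state `x` IS the field of `x`:
`stateOf v = x`. [folklore] -/
theorem stateOf_eq_of_rep_ae_eq {x : Hsp} {v : (UnitAddTorus (Fin 3)) → (EuclideanSpace ℝ (Fin 3))}
    (hv : IsSmooth v) (hd : IsDivFree v) (hm : HasZeroMean v) (h : rep x =ᵐ[volume] v) : stateOf v = x :=
  Subtype.ext (Lp.ext ((rep_stateOf hv hd hm).trans h.symm))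

/-- **On an NS phase the semiflow follows every classical trajectory**: for `x ∈ K` and ANY classical solution
`(v, q)` of NS_ν(F) on `[0, ∞)` with `rep x =ᵐ v(0)`, for `t ≥ 0`: `v(t)` has zero mean, represents `φ_t x`, and
`φ_t x = stateOf (v t)` (the phase's own trajectory of `x` agrees with `v` by forward uniqueness,
`Torus.IsClassicalNSSolutionOn.eq_of_coe_ae_eq`). [folklore] -/
theorem IsNSPhase.rep_apply_ae_eq (hν : 0 < ν) (hK : IsNSPhase ν F K φ) {x : Hsp} (hx : x ∈ K)
    {v : ℝ → (UnitAddTorus (Fin 3)) → (EuclideanSpace ℝ (Fin 3))} {q : ℝ → (UnitAddTorus (Fin 3)) → ℝ}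
    (hv : IsClassicalNSSolutionOn (Ici 0) ν (fun _ => F) v q) (hxv : rep x =ᵐ[volume] v 0) {t : ℝ} (ht : 0 ≤ t) :
    HasZeroMean (v t) ∧ rep (φ t x) =ᵐ[volume] v t ∧ φ t x = stateOf (v t) := by
  obtain ⟨u, p, hu, hrep⟩ := hK.trajectory x hx
  have hx0 : rep x =ᵐ[volume] u 0 := by
    have h := hrep 0 le_rfl
    rwa [hK.map_zero x hx] at h
  have heq : u t = v t := hu.eq_of_coe_ae_eq hν.le hv hx0 hxv ht
  have hrt : rep (φ t x) =ᵐ[volume] v t := heq ▸ hrep t ht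
  have hsm : IsSmooth (v t) := hv.smooth_velocity.isSmooth_slice (mem_Ici.2 ht)
  have hm : HasZeroMean (v t) := hasZeroMean_of_rep_ae_eq _ hrt
  exact ⟨hm, hrt, (stateOf_eq_of_rep_ae_eq hsm (hv.divFree t (mem_Ici.2 ht)) hm hrt).symm⟩

/-! ## §2 The union of an NS phase with a compact set of bounded Gevrey trajectory states -/

/-- **The enlarged phase, force-independent core.**  Let `(K, φ)` be an NS phase of NS_ν(F), `ν > 0`, and let
`K₁ ⊆ H` be the set of states of global classical mean-zero solutions of NS_ν(F) with `‖∇u(t)‖₂² ≤ R` and the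
Gevrey bound `(σ, C)`, `σ > 0`, at all `t ≥ 0` (membership characterisation `hK₁`).  Let `φ' : ℝ → H → H` agree with
`φ` on `K` and follow, at each `x ∈ K₁ ∖ K`, SOME global classical trajectory of `x` (`φ' t x = stateOf (u t)`).  Then
`(K ∪ K₁, φ')` is an NS phase of NS_ν(F), and `φ'` follows EVERY global classical trajectory issued from a state of
`K ∪ K₁`.  Ingredients: forward uniqueness (`IsNSPhase.rep_apply_ae_eq`, `Torus.IsClassicalNSSolutionOn.eq_of_coe_ae_eq`);
forward invariance and compactness of `K₁` (`Torus.trajectorySet_mem_of_shift`, `Torus.isCompact_trajectorySet`);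
joint continuity of the solution map and continuity of the enstrophy on `K₁`
(`Torus.continuousOn_solutionMap_trajectorySet`, `Torus.continuousOn_trajectorySet_of_eq_gradNormSq`), pasted with
the corresponding data of `(K, φ)` along the closed cover `{K, K₁}` (`ContinuousOn.union_of_isClosed`).
[cite: RobinsonRodrigoSadowskiCUP2016, Thm 6.10 with Thm 7.5] -/
theorem isNSPhase_union_trajectorySet (hν : 0 < ν) (hK : IsNSPhase ν F K φ) {K₁ : Set Hsp} {σ C R : ℝ} (hσ : 0 < σ)
    (hK₁ : ∀ x : Hsp, x ∈ K₁ ↔ ∃ (u : ℝ → (UnitAddTorus (Fin 3)) → (EuclideanSpace ℝ (Fin 3))) (p : ℝ → (UnitAddTorus (Fin 3)) → ℝ),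
      IsClassicalNSSolutionOn (Ici 0) ν (fun _ => F) u p ∧ (∀ t : ℝ, 0 ≤ t → HasZeroMean (u t)) ∧
      (∀ t : ℝ, 0 ≤ t → gradNormSq (u t) ≤ R) ∧
      (∀ t : ℝ, 0 ≤ t → ∀ S' : Finset (Fin 3 → ℤ), ∑ k ∈ S', Real.exp (2 * σ * Real.sqrt (freqNormSq k)) *
        ‖UnitAddTorus.mFourierCoeff (EuclideanSpace.complexify ∘ u t) k‖ ^ 2 ≤ C) ∧ rep x =ᵐ[volume] u 0)
    {φ' : ℝ → Hsp → Hsp} (hφ'K : ∀ (t : ℝ) (x : Hsp), x ∈ K → φ' t x = φ t x)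
    (hφ'₁ : ∀ x ∈ K₁, x ∉ K → ∃ (u : ℝ → (UnitAddTorus (Fin 3)) → (EuclideanSpace ℝ (Fin 3))) (p : ℝ → (UnitAddTorus (Fin 3)) → ℝ),
      IsClassicalNSSolutionOn (Ici 0) ν (fun _ => F) u p ∧ rep x =ᵐ[volume] u 0 ∧ ∀ t : ℝ, 0 ≤ t → φ' t x = stateOf (u t)) :
    IsNSPhase ν F (K ∪ K₁) φ' ∧
      ∀ x ∈ K ∪ K₁, ∀ (v : ℝ → (UnitAddTorus (Fin 3)) → (EuclideanSpace ℝ (Fin 3))) (q : ℝ → (UnitAddTorus (Fin 3)) → ℝ),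
        IsClassicalNSSolutionOn (Ici 0) ν (fun _ => F) v q → rep x =ᵐ[volume] v 0 →
        ∀ t : ℝ, 0 ≤ t → rep (φ' t x) =ᵐ[volume] v t := by
  have hd : Fintype.card (Fin 3) = 3 := Fintype.card_fin 3
  -- every state of `K ∪ K₁` launches a global classical mean-zero trajectory
  have htraj : ∀ x ∈ K ∪ K₁, ∃ (v : ℝ → (UnitAddTorus (Fin 3)) → (EuclideanSpace ℝ (Fin 3))) (q : ℝ → (UnitAddTorus (Fin 3)) → ℝ),
      IsClassicalNSSolutionOn (Ici 0) ν (fun _ => F) v q ∧ (∀ t : ℝ, 0 ≤ t → HasZeroMean (v t)) ∧ rep x =ᵐ[volume] v 0 := by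
    intro x hx
    by_cases hxK : x ∈ K
    · obtain ⟨u, p, hu, hrep⟩ := hK.trajectory x hxK
      have hx0 : rep x =ᵐ[volume] u 0 := by
        have h := hrep 0 le_rfl
        rwa [hK.map_zero x hxK] at h
      exact ⟨u, p, hu, fun t ht => hasZeroMean_of_rep_ae_eq _ (hrep t ht), hx0⟩
    · obtain ⟨u, p, hu, hum, -, -, hx0⟩ := (hK₁ x).1 (hx.resolve_left hxK)
      exact ⟨u, p, hu, hum, hx0⟩
  -- MASTER LEMMA: `φ'` follows every classical trajectory issued from a state of `K ∪ K₁`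
  have hmaster : ∀ x ∈ K ∪ K₁, ∀ (v : ℝ → (UnitAddTorus (Fin 3)) → (EuclideanSpace ℝ (Fin 3))) (q : ℝ → (UnitAddTorus (Fin 3)) → ℝ),
      IsClassicalNSSolutionOn (Ici 0) ν (fun _ => F) v q → rep x =ᵐ[volume] v 0 →
      ∀ t : ℝ, 0 ≤ t → HasZeroMean (v t) ∧ rep (φ' t x) =ᵐ[volume] v t ∧ φ' t x = stateOf (v t) := by
    intro x hx v q hv hxv t ht
    by_cases hxK : x ∈ K
    · rw [hφ'K t x hxK]
      exact hK.rep_apply_ae_eq hν hxK hv hxv ht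
    · have hx₁ : x ∈ K₁ := hx.resolve_left hxK
      obtain ⟨u, p, hu, hxu, hφ'u⟩ := hφ'₁ x hx₁ hxK
      obtain ⟨u', p', hu', hum', -, -, hxu'⟩ := (hK₁ x).1 hx₁
      have h1 : u t = v t := hu.eq_of_coe_ae_eq hν.le hv hxu hxv ht
      have h2 : u' t = v t := hu'.eq_of_coe_ae_eq hν.le hv hxu' hxv ht
      have hm : HasZeroMean (v t) := h2 ▸ hum' t ht
      have hsm : IsSmooth (v t) := hv.smooth_velocity.isSmooth_slice (mem_Ici.2 ht)
      rw [hφ'u t ht, h1]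
      exact ⟨hm, rep_stateOf hsm (hv.divFree t (mem_Ici.2 ht)) hm, rfl⟩
  -- compactness and closedness
  have hK₁c : IsCompact K₁ := isCompact_trajectorySet hd hν hσ hK₁
  -- forward invariance
  have hmaps : ∀ t : ℝ, 0 ≤ t → MapsTo (φ' t) (K ∪ K₁) (K ∪ K₁) := by
    intro t ht x hx
    by_cases hxK : x ∈ K
    · rw [hφ'K t x hxK]
      exact Or.inl (hK.mapsTo t ht hxK)
    · have hx₁ : x ∈ K₁ := hx.resolve_left hxK
      obtain ⟨u, p, hu, hum, huR, huG, hxu⟩ := (hK₁ x).1 hx₁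
      obtain ⟨-, hrep, -⟩ := hmaster x hx u p hu hxu t ht
      exact Or.inr (trajectorySet_mem_of_shift hK₁ hu hum huR huG ht hrep)
  refine ⟨{ isCompact := hK.isCompact.union hK₁c
            mapsTo := hmaps
            map_zero := fun x hx => ?_
            map_add := fun s t hs ht x hx => ?_
            continuousOn := ?_
            enstrophy_finite := fun x hx => ?_
            enstrophy_continuousOn := ?_
            trajectory := fun x hx => ?_ }, fun x hx v q hv hxv t ht => (hmaster x hx v q hv hxv t ht).2.1⟩
  · -- `φ'_0 = id`
    obtain ⟨v, q, hv, hvm, hxv⟩ := htraj x hx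
    obtain ⟨-, -, h0⟩ := hmaster x hx v q hv hxv 0 le_rfl
    rw [h0]
    exact stateOf_eq_of_rep_ae_eq (hv.smooth_velocity.isSmooth_slice (mem_Ici.2 le_rfl)) (hv.divFree 0 (mem_Ici.2 le_rfl))
      (hvm 0 le_rfl) hxv
  · -- semigroup law: both sides are `stateOf (v (s + t))` for the trajectory `v` of `x`
    obtain ⟨v, q, hv, -, hxv⟩ := htraj x hx
    obtain ⟨-, hrep_t, -⟩ := hmaster x hx v q hv hxv t ht
    have hy : φ' t x ∈ K ∪ K₁ := hmaps t ht hx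
    have hshift := hv.shift_Ici ht
    have hy0 : rep (φ' t x) =ᵐ[volume] (fun τ => v (τ + t)) 0 := by simpa only [zero_add] using hrep_t
    obtain ⟨-, -, h₁⟩ := hmaster (φ' t x) hy _ _ hshift hy0 s hs
    obtain ⟨-, -, h₂⟩ := hmaster x hx v q hv hxv (s + t) (add_nonneg hs ht)
    rw [h₂, h₁]
  · -- joint continuity on `Ici 0 ×ˢ (K ∪ K₁)`: pasting along the closed cover
    rw [prod_union]
    refine ContinuousOn.union_of_isClosed ?_ ?_ (isClosed_Ici.prod hK.isCompact.isClosed) (isClosed_Ici.prod hK₁c.isClosed)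
    · exact hK.continuousOn.congr fun q hq => hφ'K q.1 q.2 hq.2
    · exact continuousOn_solutionMap_trajectorySet hd hν hσ hK₁ φ'
        fun x hx u p hu hxu t ht => (hmaster x (Or.inr hx) u p hu hxu t ht).2.1
  · -- finite enstrophy
    obtain ⟨v, q, hv, -, hxv⟩ := htraj x hx
    rw [Literature.Analysis.FluidPDE.eGradNormSq_congr_ae hxv]
    exact (eGradNormSq_lt_top (hv.smooth_velocity.isSmooth_slice (mem_Ici.2 le_rfl))).ne
  · -- continuity of the enstrophy: pasting along the closed cover
    refine ContinuousOn.union_of_isClosed hK.enstrophy_continuousOn ?_ hK.isCompact.isClosed hK₁c.isClosed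
    exact continuousOn_trajectorySet_of_eq_gradNormSq hσ hK₁ enstrophyObs
      fun x _ v hv h => stub_trajectoryPowerBudget_aux_enstrophyObs_eq x hv h
  · -- trajectories
    obtain ⟨v, q, hv, -, hxv⟩ := htraj x hx
    exact ⟨v, q, hv, fun t ht => (hmaster x hx v q hv hxv t ht).2.1⟩

end EnlargedPhase

/-! ## §3 The registered tools stub -/

/-- **Tools stub P1 — THE ENLARGED PHASE (block N-P).**  An NS phase `(K, φ)` of the designer force `f_c` at
viscosity `ν > 0` embeds (`K ⊆ K'`, `φ' = φ` on `[0,∞) × K`) into an NS phase `(K', φ')` of the same force which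
carries, for a prescribed enstrophy level `R`, the forward orbit of every state at a time `≥ 1` of every GLOBAL
classical mean-zero solution with `‖∇u(t)‖₂² ≤ R` for all `t ≥ 0`, with `φ'` acting on it as the solution map.
Construction: `K' := K ∪ K₁`, `K₁ :=` the states `u(0)` of the global classical mean-zero solutions with
`‖∇u(t)‖₂² ≤ R` AND the uniform Gevrey bound of E9 (`σ, C` of `Torus.IsClassicalNSSolutionOn.gevrey_of_gradNormSq_le`
for `(ν, R, τ = 1, f_c)`, the force being band-limited: `force_gevreyLevel_freqBall_le`) at all `t ≥ 0`; `φ' := φ`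
on `K`, the solution map on `K₁ ∖ K`; `isNSPhase_union_trajectorySet` makes `(K', φ')` an NS phase following every
classical trajectory, and states at times `s ≥ 1` of bounded-enstrophy global solutions lie in `K₁`
(`Torus.trajectorySet_mem_of_one_le`), their trajectory being `u(s + ·)`.
[cite: RobinsonRodrigoSadowski2016, Thm 6.10 with Thm 7.5] -/
theorem stub_enlargedPhaseTools {S : Finset (Fin 3 → ℤ)} {c : ↥S → (EuclideanSpace ℂ (Fin 3))} {ν : ℝ} {K : Set Hsp}
    {φ : ℝ → Hsp → Hsp} (hν : 0 < ν) (hK : IsNSPhase ν (force S c) K φ) (R : ℝ) :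
    ∃ (K' : Set Hsp) (φ' : ℝ → Hsp → Hsp), K ⊆ K' ∧ (∀ t : ℝ, 0 ≤ t → ∀ x ∈ K, φ' t x = φ t x) ∧
      IsNSPhase ν (force S c) K' φ' ∧
      ∀ (u : ℝ → (UnitAddTorus (Fin 3)) → (EuclideanSpace ℝ (Fin 3))) (p : ℝ → (UnitAddTorus (Fin 3)) → ℝ),
        IsClassicalNSSolutionOn (Ici 0) ν (fun _ => force S c) u p → (∀ t : ℝ, 0 ≤ t → HasZeroMean (u t)) →
        (∀ t : ℝ, 0 ≤ t → gradNormSq (u t) ≤ R) →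
        ∀ s : ℝ, 1 ≤ s → ∃ x ∈ K', ∀ t : ℝ, 0 ≤ t → rep (φ' t x) =ᵐ[volume] u (s + t) := by
  classical
  -- the Gevrey constants of E9 for the level `R`, the lapse `1` and the band-limited force `f_c`
  obtain ⟨σ, hσ, C, hC⟩ := IsClassicalNSSolutionOn.gevrey_of_gradNormSq_le (d := Fin 3)
    (Fintype.card_fin 3).le hν R 1
    (∑ k ∈ S ∪ S.image (fun k => -k), Real.exp (1 * Real.sqrt (freqNormSq k)) ^ 2 *
      (freqNormSq k * ‖UnitAddTorus.mFourierCoeff (EuclideanSpace.complexify ∘ force S c) k‖ ^ 2))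
    one_pos
  have hE9 : ∀ {a : ℝ} {u : ℝ → (UnitAddTorus (Fin 3)) → (EuclideanSpace ℝ (Fin 3))} {p : ℝ → (UnitAddTorus (Fin 3)) → ℝ},
      IsClassicalNSSolutionOn (Icc a (a + 1)) ν (fun _ => force S c) u p → (∀ t ∈ Icc a (a + 1), HasZeroMean (u t)) →
      (∀ t ∈ Icc a (a + 1), gradNormSq (u t) ≤ R) →
      ∀ S' : Finset (Fin 3 → ℤ), ∑ k ∈ S', Real.exp (2 * σ * Real.sqrt (freqNormSq k)) *
        ‖UnitAddTorus.mFourierCoeff (EuclideanSpace.complexify ∘ u (a + 1)) k‖ ^ 2 ≤ C :=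
    fun h hm hR S' => hC h hm hR (fun _ _ Rr => force_gevreyLevel_freqBall_le S c 1 Rr) S'
  -- the set `K₁` and the solution map on it
  set K₁ : Set Hsp := {x | ∃ (u : ℝ → (UnitAddTorus (Fin 3)) → (EuclideanSpace ℝ (Fin 3))) (p : ℝ → (UnitAddTorus (Fin 3)) → ℝ),
      IsClassicalNSSolutionOn (Ici 0) ν (fun _ => force S c) u p ∧ (∀ t : ℝ, 0 ≤ t → HasZeroMean (u t)) ∧
      (∀ t : ℝ, 0 ≤ t → gradNormSq (u t) ≤ R) ∧
      (∀ t : ℝ, 0 ≤ t → ∀ S' : Finset (Fin 3 → ℤ), ∑ k ∈ S', Real.exp (2 * σ * Real.sqrt (freqNormSq k)) *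
        ‖UnitAddTorus.mFourierCoeff (EuclideanSpace.complexify ∘ u t) k‖ ^ 2 ≤ C) ∧ rep x =ᵐ[volume] u 0} with hK₁_def
  have hK₁ : ∀ x : Hsp, x ∈ K₁ ↔ ∃ (u : ℝ → (UnitAddTorus (Fin 3)) → (EuclideanSpace ℝ (Fin 3))) (p : ℝ → (UnitAddTorus (Fin 3)) → ℝ),
      IsClassicalNSSolutionOn (Ici 0) ν (fun _ => force S c) u p ∧ (∀ t : ℝ, 0 ≤ t → HasZeroMean (u t)) ∧
      (∀ t : ℝ, 0 ≤ t → gradNormSq (u t) ≤ R) ∧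
      (∀ t : ℝ, 0 ≤ t → ∀ S' : Finset (Fin 3 → ℤ), ∑ k ∈ S', Real.exp (2 * σ * Real.sqrt (freqNormSq k)) *
        ‖UnitAddTorus.mFourierCoeff (EuclideanSpace.complexify ∘ u t) k‖ ^ 2 ≤ C) ∧ rep x =ᵐ[volume] u 0 :=
    fun x => Iff.rfl
  set φ' : ℝ → Hsp → Hsp := fun t x =>
    if x ∈ K then φ t x
    else if h : x ∈ K₁ then stateOf (h.choose t) else x with hφ'_def
  have hφ'K : ∀ (t : ℝ) (x : Hsp), x ∈ K → φ' t x = φ t x := fun t x hx => by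
    simp only [hφ'_def, if_pos hx]
  have hφ'₁ : ∀ x ∈ K₁, x ∉ K → ∃ (u : ℝ → (UnitAddTorus (Fin 3)) → (EuclideanSpace ℝ (Fin 3))) (p : ℝ → (UnitAddTorus (Fin 3)) → ℝ),
      IsClassicalNSSolutionOn (Ici 0) ν (fun _ => force S c) u p ∧ rep x =ᵐ[volume] u 0 ∧
      ∀ t : ℝ, 0 ≤ t → φ' t x = stateOf (u t) := by
    intro x hx hxK
    refine ⟨hx.choose, hx.choose_spec.choose, hx.choose_spec.choose_spec.1, hx.choose_spec.choose_spec.2.2.2.2,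
      fun t _ => ?_⟩
    simp only [hφ'_def, if_neg hxK, dif_pos hx]
  obtain ⟨hphase, hfollow⟩ := isNSPhase_union_trajectorySet hν hK hσ hK₁ hφ'K hφ'₁
  refine ⟨K ∪ K₁, φ', subset_union_left, fun t _ x hx => hφ'K t x hx, hphase, fun u p hsol hmean hR s hs => ?_⟩
  -- the state `[u(s)]`, `s ≥ 1`, lies in `K₁`, and its trajectory is `u(s + ·)`
  have hs0 : 0 ≤ s := zero_le_one.trans hs
  have hus : IsSmooth (u s) := hsol.smooth_velocity.isSmooth_slice (mem_Ici.2 hs0)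
  have hrep : rep (stateOf (u s)) =ᵐ[volume] u s := rep_stateOf hus (hsol.divFree s (mem_Ici.2 hs0)) (hmean s hs0)
  have hmem : stateOf (u s) ∈ K₁ := trajectorySet_mem_of_one_le hK₁ hE9 hsol hmean hR hs hrep
  refine ⟨stateOf (u s), Or.inr hmem, fun t ht => ?_⟩
  have h := hfollow (stateOf (u s)) (Or.inr hmem) _ _ (hsol.shift_Ici hs0) (by simpa only [zero_add] using hrep) t ht
  simpa only [add_comm t s] using h

end Summit.AnomalousDissipation.AnomalousDissipation.Theorems.DenseLoudDesignerForces.Ergodic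

end
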